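import Literature.Dynamics.NBody.AlbouyKaloshin2012Sec892

/-!
# The 8.9.2 mass polynomial on the Roberts orbit `(4,4,4,4,1)`

[AlbouyKaloshin2012] Remark 8 (p. 583): "A 5-tuple of masses with some equal masses easily falls in the
exceptional set. This is consistent with Roberts' counter-example and with the analogous complex
counter-example we presented in Section 2. In these examples, the masses are respectively
`(4, 4, 4, 4, −1)` and `(4, 4, 4, 4, 1)`."  Besides the printed relations (23), (29), (32), (39) it
satisfies, the recomputed degree-24 polynomial of §8.9.2 (`F892`, file `AlbouyKaloshin2012Sec892`)
ALSO vanishes on this orbit — exactly when the small mass occupies the third slot of the §8.9.2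
numbering (kernel-decided integer evaluations below; found by the pub-smale6 membership certificate,
two independent implementations, 24 = 4! of the 120 renumberings).

No new `def … : Prop` facts; only decided evaluations of an existing definition and their transfer
to `ℝ` via `F892_cast`.
-/

namespace Literature.Dynamics.NBody

set_option maxRecDepth 200000 in
/-- `F892 (4,4,1,4,4) = 0`: the 8.9.2 polynomial vanishes on the Roberts masses with the unit mass
in slot 3. [cite: AlbouyKaloshin2012, Remark 8 p. 583] -/
theorem F892_roberts_slot3 : F892 (4 : ℤ) 4 1 4 4 = 0 := by
  decide

set_option maxRecDepth 200000 in
/-- … and does not vanish with the unit mass in any other slot. [cite: AlbouyKaloshin2012, Remark 8 p. 583] -/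
theorem F892_roberts_other_slots :
    F892 (1 : ℤ) 4 4 4 4 ≠ 0 ∧ F892 (4 : ℤ) 1 4 4 4 ≠ 0 ∧
    F892 (4 : ℤ) 4 4 1 4 ≠ 0 ∧ F892 (4 : ℤ) 4 4 4 1 ≠ 0 := by
  decide

/-- The Roberts–Albouy–Kaloshin masses `(4,4,4,4,1)` as real numbers. [cite: AlbouyKaloshin2012, Remark 8 p. 583] -/
def robertsMassesAK : Fin 5 → ℝ := fun i => (((![4, 4, 4, 4, 1] : Fin 5 → ℤ) i : ℤ) : ℝ)

/-- Relation 8.9.2 holds on `(4,4,4,4,1)` under the renumbering `(1,2,5,3,4)` (masses read as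
`(4,4,1,4,4)`). [cite: AlbouyKaloshin2012, Remark 8 p. 583] -/
theorem rel892_robertsMassesAK : Rel892 robertsMassesAK 0 1 4 2 3 := by
  unfold Rel892 robertsMassesAK
  have h := F892_roberts_slot3
  have hc := F892_cast 4 4 1 4 4
  rw [h] at hc
  push_cast at hc
  simpa using hc.symm

/-- … and fails under the identity renumbering (masses read as `(4,4,4,4,1)`). [cite: AlbouyKaloshin2012, Remark 8 p. 583] -/
theorem not_rel892_robertsMassesAK_id : ¬ Rel892 robertsMassesAK 0 1 2 3 4 := by
  unfold Rel892 robertsMassesAK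
  intro h
  have hne := F892_roberts_other_slots.2.2.2
  apply hne
  have hc := F892_cast 4 4 4 4 1
  have : F892 (4 : ℝ) 4 4 4 1 = 0 := by simpa using h
  push_cast at hc
  rw [this] at hc
  exact_mod_cast hc

end Literature.Dynamics.NBody
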